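import Summits.BirchSwinnertonDyer.BirchSwinnertonDyer.Theorems.PrintCFramBottomClassIndexLawFiveLeRegularLocusBSDp
import HarnessLib

/-!
# Route `PrintCFram`, crux C2 `BottomClassIndexLawFiveLe` (stmt-BirchSwinnertonDyer-20372), line `eisenstein-resource-bdp-line`
# (registry v6 → v7): the LOWER index half on the WHOLE Kriz–Li locus from PRINT (no regularity), and the crux's conclusion
# from ONE finite-level Kolyvagin inequality there; off the locus from that inequality and the Eisenstein ♭-inclusion alone

Cell `bsd-print-cfram`, LEAD seat `bsd-line-cfram-p1` (generation g6), `--supports stmt-BirchSwinnertonDyer-20372` (helper).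
HONEST FRAMING. The crux C2 is CLASS-WIDE and stays OPEN. Nothing here is a new definition or a new named fact; every theorem
is CONDITIONAL on the displayed published facts (taken BY NAME) and, where it says so, on the two research statements of the
reshaped skeleton v7 — the finite-level Kolyvagin UPPER inequality `Upper.IndexUpperBoundLeAt` at a Borel CM-ramified prime
(the stub `stub_kolyvaginUpper_borelCM` of the published line `borel_heegner_squeeze`, bsd-idea-7 g4, adopted into the line of
record) and the ♭-(∅,0) Eisenstein inclusion β1 OFF the Kriz–Li locus. BSD is not proved by any of this; no summit statement is
proved by this seat.

THE CLASS. `W/ℚ` globally minimal with CM, `p ≥ 5` CM-ramified (`p ∈ {7, 11, 19, 43, 67, 163}`), `r_an(W) = 1`; `W` is additive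
potentially supersingular at `p`, `p² ∣ N_W`, `W[𝔭]` a rational line (`ρ̄_{W,p}` Borel).

WHAT IS PROVED (v6 → v7 of the line; LEAD g5's regular-locus theorem `RegularLocus.bsdp_cmRamified_of_regularKrizLiDatum` used
the regularity hypothesis `hreg` for BOTH index halves — it is needed for the UPPER half only):

* §1 `indexLowerBoundLeAt_cmRamified_of_krizLiDatum` — at EVERY Kriz–Li Heegner datum of a class member (a Heegner field `K` of
  `N_W` with `L(W^{(d_K)}, 1) ≠ 0`, Kriz–Li's binders `ψ, ω, (1), (3)` at `(W, p)` and `ε_K`, (4) `B_{1,ψ₀⁻¹ε_K}·B_{1,ψ₀ω⁻¹} ≢ 0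
  (mod p)` at `K`; (2) is automatic for CM) the LOWER index half `IndexLowerBoundLeAt W p K P (v_p c)` —
  `2·ord_p [W(K) : ℤP] ≤ ord_p #Ш(W/K) + 2·ord_p ∏ c_ℓ + 2·v_p(c)` — holds from PRINT ONLY: Kriz–Li 2019 Thm. 1.20 gives
  `ord_p log_ω P ≤ v_p(c)` (door-c2's `padicLogOrd_le_padicValInt_of_krizLi`), CTL₀ (`∃ n, HasCharValuationAt n`) comes from the
  class's exact anticyclotomic control (the `W(ℚ_p)[p] = 0` door, `additiveControl_heegner_of_cmRamified`, modulo Poitou–Tate for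
  Ш and Kolyvagin), and K1's link `indexLowerBoundLeAt_of_imcLowerLe_of_control` turns the pair into the index half. NO regularity,
  NO main conjecture, NO `p`-adic `L`-function, NO ♭-frame.
* §2 `bsdp_cmRamified_of_krizLiDatum_of_indexUpper` / `ramifiedCMBottomClassIndexLawAtZp_of_krizLiDatum_of_indexUpper` — hence at a
  Kriz–Li datum the crux's conclusion for `W` needs exactly ONE more input: the UPPER index half `Upper.IndexUpperBoundLeAt W p K P
  (v_p c)` AT THAT DATUM (Kolyvagin's direction: `ord_p #Ш(W/K) + 2·ord_p ∏ c_ℓ + 2·v_p(c) ≤ 2·ord_p [W(K) : ℤP]`), through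
  `SchneiderFree.Exact.bsdp_of_exactIndexManin_of_partner_bsdp` and Burungale–Flach for the rank-zero CM partner. On the REGULAR
  sub-locus that input is itself print (LEAD g5, p630429); §2b `hasCharValuationAt_zero_of_indexUpper_of_krizLiDatum` records the
  converse bookkeeping: at a Kriz–Li datum the UPPER half FORCES the frame to be regular (`n = 0`), so on the Kriz–Li locus
  «Kolyvagin's inequality», «regularity» and «`BSD_p(W)`» are the same statement modulo print.
* (sequel file `…EisensteinEndStateV7`) §3 `bsdp_cmRamified_of_flatIncl_of_indexUpper` — OFF the locus (indeed for ANY class member): the Eisenstein ♭-inclusion β1 at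
  the Heegner data of `W` (with its v3 torsion hypothesis, discharged here from control at `𝔭′`) gives the LOWER half
  (`indexLowerBoundLeAt_of_flatInclLe_of_control`, Hsieh + LZZ for the frame value), the Kolyvagin inequality the UPPER half, and the
  row theorem `bsdp_of_indexHalves_of_twist_row` (Friedberg–Hoffstein datum inside `ToricPublishedInputs`) gives `BSD_p(W)` — the
  analytic stub (AN) of v4–v6 and the PRINT stub `stub_residualCharacterSelmerFinite` are NOT needed.
* (sequel file) §4 `bottomClassIndexLawFiveLe_of_prints7_of_krizLi_of_kolyvaginUpper_of_flatInclOffKrizLi` — the v7 END STATE: the crux BY NAME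
  from the seven citations of `stub_prints`, Kriz–Li Thm. 1.20, the Kolyvagin inequality on the class (verbatim the signature of
  `BorelHeegnerSqueeze.stub_kolyvaginUpper_borelCM`) and β1 restricted to the members with NO Kriz–Li datum.

References: [KrizLi2019] Thm. 1.20 (pp. 7–8), Rem. 1.17, Rem. 1.21; [JetchevSkinnerWan2017] §7.4.1, Thm. 3.3.1; [GrossZagier1986]
I.(6.3), Thm. I.7.3; [Kolyvagin1990] Thm. A; [Jetchev2008] Thm. 1.4; [GrigorovJorzaPatrikisSteinTarnita2009] Thm. 3.7;
[BurungaleFlach2024] Thm. 1.1, Cor. 2; [Hsieh2014] Thm. A; [LiuZhangZhang2018] Thm. 1.5.1/1.5.3; [FriedbergHoffstein1995] Thm. B;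
[Cassels1965ArithmeticVIII]; [CastellaGrossiLeeSkinner2022] Thm. 5.3.1.
-/

set_option autoImplicit false
-- the summit namespace `Summit.BirchSwinnertonDyer.BirchSwinnertonDyer` repeats the problem name by design (D-0017)
set_option linter.dupNamespace false

noncomputable section

open scoped Classical

namespace Summit.BirchSwinnertonDyer.BirchSwinnertonDyer.Theorems.PrintCFram.KrizLiKolyvagin

open WeierstrassCurve NumberField IsDedekindDomain Field PowerSeries
  Literature.NumberTheory.EllipticCurves Literature.NumberTheory.EllipticCurves.GreenbergSelmer
  Literature.NumberTheory.EllipticCurves.GreenbergVatsal2000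
  Literature.NumberTheory.EllipticCurves.ModularForms
  Literature.NumberTheory.EllipticCurves.KrizLi2019
  Literature.NumberTheory.GaloisCohomology
  Literature.NumberTheory.EllipticCurves.Rank1Residual
  Literature.NumberTheory.EllipticCurves.Rank1Residual.Typed
  Literature.NumberTheory.GaloisRepresentations
  Summit.BirchSwinnertonDyer.Rank1Residual
  Summit.BirchSwinnertonDyer.Rank1Residual.Additive
  Summit.BirchSwinnertonDyer.Rank1Residual.X11b Summit.BirchSwinnertonDyer.Rank1Residual.X11b.AcSelmer
  Summit.BirchSwinnertonDyer.Rank1Residual.X11b.Halves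
  Summit.BirchSwinnertonDyer.Rank1Residual.X12
  Summit.BirchSwinnertonDyer.Rank1Residual.X2.ResidualDevissageModules
  Summit.BirchSwinnertonDyer.BirchSwinnertonDyer.Theses.UniversalToricDescent
  Summit.BirchSwinnertonDyer.BirchSwinnertonDyer.Theorems
  Summit.BirchSwinnertonDyer.BirchSwinnertonDyer.Theorems.SchneiderFree
  Summit.BirchSwinnertonDyer.BirchSwinnertonDyer.Theorems.UniversalToricDescentWaldspurgerFlat
  Summit.BirchSwinnertonDyer.BirchSwinnertonDyer.Theorems.UniversalToricDescentStrictPlace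
  Summit.BirchSwinnertonDyer.BirchSwinnertonDyer.Theorems.RamifiedSevenEllipticUnits
  Summit.BirchSwinnertonDyer.BirchSwinnertonDyer.Theorems.PrintCFram
  Summit.BirchSwinnertonDyer.BirchSwinnertonDyer.Theorems.PrintCFram.EisensteinResourceBdpLine

/-! ## §1 The LOWER index half at every Kriz–Li datum of the class — print only, no regularity -/

section Lower

variable {p : ℕ} [Fact p.Prime]

/-- **LOWER index half at slack `v_p(c)` at EVERY Kriz–Li Heegner datum of the CM-ramified class, from PRINT ONLY.** Inputs BY
NAME: Poitou–Tate for Ш (`hPT2`), Kolyvagin (`hKo`), Kriz–Li 2019 Thm. 1.20 (`hKL`); the four other control facts are tree theorems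
(`prints_four_hold`). Data: `W` CM, `p ≥ 5` CM-ramified; a Heegner datum `(N = N_W, K, Dt, H, ι, P)` with `L(W^{(d_K)},1) ≠ 0` and
`P` non-torsion; Kriz–Li's binders `ψ, ω, (1), (3)` at `(W, p)` ((2) is automatic for CM) and `ε_K`, (4) at `K`. NO regularity
hypothesis, no frame among the hypotheses (an anticyclotomic frame `(κ, γ, 𝔭)` is chosen inside; CTL₀ there is exact control).
Conclusion: `IndexLowerBoundLeAt W p K P (v_p c)`, i.e. `2·ord_p [W(K):ℤP] ≤ ord_p #Ш(W/K) + 2·ord_p ∏ c_ℓ + 2·v_p(c)`.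
[cite: KrizLi2019, Thm. 1.20 (pp. 7–8), Rem. 1.17 (p. 6), Rem. 1.21 (p. 8)] [cite: JetchevSkinnerWan2017, §7.4.1 and Thm. 3.3.1 (arXiv:1512.06894 pp. 11, 30)] -/
theorem indexLowerBoundLeAt_cmRamified_of_krizLiDatum
    (hPT2 : ∀ (K : Type) [Field K] [NumberField K], poitouTate_sha_tateDual K)
    (hKo : ∀ (N : ℕ) [NeZero N] (W : WeierstrassCurve ℚ) (K : Type) [Field K] [NumberField K],
      Literature.NumberTheory.EllipticCurves.kolyvagin N W K)
    (hKL : KrizLi2019.thm120_padicLogHeegner_unit_of_bernoulli)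
    (W : WeierstrassCurve ℚ) [W.IsElliptic] [W.IsGloballyMinimal] (hCM : W.HasCM) (hram : CMRamified W p) (h5 : 5 ≤ p)
    (N : ℕ) [NeZero N] (K : Type) [Field K] [NumberField K]
    (Dt : ModularParametrizationData W N) (H : HeegnerDatum N (NumberField.discr K)) (ι : K →+* ℂ)
    (P : (W.baseChange K).toAffine.Point)
    (hN : W.conductorNorm ℤ = N) (hK : IsImaginaryQuadratic K) (hHN : SatisfiesHeegnerHypothesis N K)
    (hLt : (W.quadraticTwist (NumberField.discr K : ℚ)).entireLFunction 1 ≠ 0)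
    (hP : WeierstrassCurve.Affine.Point.map ι.toRatAlgHom P = heegnerPointComplex Dt H) (hnt : ¬ IsOfFinAddOrder P)
    -- Kriz–Li's binders at `(W, p)`
    (f : ℕ) [NeZero f] (ψ : DirichletCharacter ℚ_[p] f) (ω : DirichletCharacter ℚ_[p] p)
    (hψ : ψ.IsPrimitive) (hω : KrizLi2019.IsTeichmullerCharacter ω)
    (hss : ∀ ℓ : ℕ, ℓ.Prime → ¬ (ℓ ∣ p * W.conductorNorm ℤ) →
      ‖((W.LFunction ℓ : ℤ) : ℚ_[p]) - (ψ (ℓ : ZMod f) + ψ⁻¹ (ℓ : ZMod f) * ω (ℓ : ZMod p))‖ < 1)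
    (h1 : ψ (p : ZMod f) ≠ 1) (h1' : KrizLi2019.primVal (KrizLi2019.invMulOmega ψ ω) p ≠ 1)
    (h3 : ∀ ℓ : ℕ, (hℓ : ℓ.Prime) → ℓ ≠ p →
      (haveI := Fact.mk hℓ; ¬ W.HasGoodReductionAtPrime ℓ ∧ ¬ W.HasMultiplicativeReductionAtPrime ℓ) →
      ψ (ℓ : ZMod f) ≠ 1 ∧ KrizLi2019.primVal (KrizLi2019.invMulOmega ψ ω) ℓ ≠ 1)
    -- Kriz–Li's binders at `K`
    (εK : DirichletCharacter ℚ_[p] (NumberField.discr K).natAbs) (hεK : KrizLi2019.IsKroneckerCharacterOf K εK)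
    (h4 : ¬ (‖KrizLi2019.bernoulliOnePrim (KrizLi2019.bernoulliCharOne ψ εK) *
        KrizLi2019.bernoulliOnePrim (KrizLi2019.bernoulliCharTwo ψ εK ω)‖ ≤ (p : ℝ)⁻¹)) :
    IndexLowerBoundLeAt W p K P (padicValNat p Dt.c.natAbs) := by
  have hp : p.Prime := Fact.out
  have hp2 : p ≠ 2 := by omega
  obtain ⟨hPT, hEP, hcd, hBr⟩ := EisensteinResourceBdpLine.prints_four_hold
  have hadd : Addv W p := addv_of_cmRamified W hCM hram h5
  have hpNW : p ∣ W.conductorNorm ℤ := (W.dvd_conductorNorm_iff_not_hasGoodReductionAtPrime p).mpr hadd.1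
  have hpN : p ∣ N := by rw [← hN]; exact hpNW
  have hsplit : ((Ideal.span {(p : ℤ)}).primesOver (𝓞 K)).ncard = 2 := hHN p hp hpN
  -- an anticyclotomic frame `(κ, γ, 𝔭)` with `𝔭 ∣ p` of degree one
  obtain ⟨κ, γ, -, hκ, hγ, -⟩ := X11b.exists_anticyclotomic_generator_prime (p := p) hK
  haveI : Fact (κ.IsTopGenerator γ) := ⟨hγ⟩
  obtain ⟨𝔭, h𝔭, he, hf⟩ := X11b.exists_degreeOnePrime_of_splitsIn K p hK.1 hsplit
  obtain ⟨_, hfin⟩ := hKo N W K hK hHN ⟨Dt, H, ι, hP⟩ hnt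
  -- exact control at the frame (the `W(ℚ_p)[p] = 0` door); CTL₀ is its first component
  have hCtl : AdditiveControlOnTreeAt p κ 𝔭 γ (embAt K p 𝔭 h𝔭 he hf) P :=
    additiveControl_heegner_of_cmRamified hPT hPT2 hEP hcd hBr W hCM hram h5 N K Dt H ι P hN hK hHN hLt hP hnt
      (hKo N W K) κ hκ γ 𝔭 h𝔭 he hf
  have hCTL0 : ∃ n : ℕ, XAc.HasCharValuationAt (W.baseChange K) p κ 𝔭 ∅ γ n := by
    obtain ⟨n, hn, -⟩ := hCtl
    exact ⟨n, hn⟩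
  -- (2) «no split multiplicative prime» is automatic for CM
  have h2 : ∀ ℓ : ℕ, (hℓ : ℓ.Prime) → ¬ (haveI := Fact.mk hℓ; W.HasSplitMultiplicativeReductionAtPrime ℓ) :=
    fun ℓ hℓ hsp ↦ by
      haveI := Fact.mk hℓ
      exact W.not_hasMultiplicativeReductionAtPrime_of_hasCM hCM ℓ hsp.hasMultiplicativeReductionAtPrime
  -- the LOWER socket from Kriz–Li Thm. 1.20 by name, fed with CTL₀ only
  have hlow : AdditiveIMCLowerBDPOnTreeLeAt p κ 𝔭 γ (embAt K p 𝔭 h𝔭 he hf) (padicValNat p Dt.c.natAbs) P := by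
    subst hN
    haveI : NeZero (NumberField.discr K).natAbs := ⟨Int.natAbs_ne_zero.mpr (NumberField.discr_ne_zero K)⟩
    have hne := hKL p hp2 W f ψ ω hψ hω hss h1 h1' h2 h3 Dt K hK hHN hsplit εK hεK H ι (embAt K p 𝔭 h𝔭 he hf) P hP h4
    exact additiveIMCLowerBDPOnTreeLeAt_of_charTorsion_of_krizLi hCTL0 (nsPointCount_eq_self_of_addv hadd) hne
  exact SchneiderFreeAdditiveX3.indexLowerBoundLeAt_of_imcLowerLe_of_control hN hK hHN hfin hlow hCtl

end Lower

/-! ## §2 At a Kriz–Li datum: `BSD_p(W)` and the crux's conclusion from the UPPER index half alone -/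

section KrizLiDatum

variable {p : ℕ} [Fact p.Prime]

/-- **`BSD_p(W)` at a KRIZ–LI DATUM of the CM-ramified class from the UPPER index half at that datum** (and print). The seven
citations of the line's `stub_prints` (Hsieh 2014 Thm. A, LZZ 2018, `ToricPublishedInputs`, Poitou–Tate for Ш, Burungale–Flach 2024 /
Rubin, modularity, Cassels) plus Kriz–Li 2019 Thm. 1.20; a Heegner datum with `d_K` odd `< −4`, `L(W^{(d_K)},1) ≠ 0` carrying
Kriz–Li's binders; and ONE hypothesis beyond print: `Upper.IndexUpperBoundLeAt W p K P (v_p c)` at that datum (Kolyvagin's direction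
of the Heegner-index identity, Manin slack). The LOWER half is §1 (print); the partner `BSD_p` of a globally minimal model of
`W^{(d_K)}` is Burungale–Flach (CM, rank zero); then `SchneiderFree.Exact.bsdp_of_exactIndexManin_of_partner_bsdp`. CONDITIONAL.
[cite: KrizLi2019, Thm. 1.20 (pp. 7–8)] [cite: GrossZagier1986, Thm. I.(6.3) and (7.3)] [cite: BurungaleFlach2024, Thm. 1.1 and Cor. 2]
[cite: Jetchev2008, Thm. 1.4] [cite: GrigorovJorzaPatrikisSteinTarnita2009, Thm. 3.7] -/
theorem bsdp_cmRamified_of_krizLiDatum_of_indexUpper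
    (hprints : Hsieh2014.thmA_exists_isHsiehLFunction_unrPeriod_anyLevel ∧
      LiuZhangZhang2018.thm151_thm153_modularCurve_heegnerVector_additive ∧
      ToricPublishedInputs ∧
      (∀ (K : Type) [Field K] [NumberField K], poitouTate_sha_tateDual K) ∧
      bsdTriple_of_hasCM_of_L_one_ne_zero ∧ hasEntireLFunction_rat ∧ bsdRHS_eq_of_isIsogenous)
    (hKL : KrizLi2019.thm120_padicLogHeegner_unit_of_bernoulli)
    (W : WeierstrassCurve ℚ) [W.IsElliptic] [W.IsGloballyMinimal] (hCM : W.HasCM) (hram : CMRamified W p) (h5 : 5 ≤ p)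
    (hr : W.analyticRank = 1)
    (N : ℕ) [NeZero N] (K : Type) [Field K] [NumberField K]
    (Dt : ModularParametrizationData W N) (H : HeegnerDatum N (NumberField.discr K)) (ι : K →+* ℂ)
    (P : (W.baseChange K).toAffine.Point)
    (hN : W.conductorNorm ℤ = N) (hK : IsImaginaryQuadratic K) (hHN : SatisfiesHeegnerHypothesis N K)
    (hodd : Odd (NumberField.discr K)) (hd4 : NumberField.discr K < -4)
    (hLt : (W.quadraticTwist (NumberField.discr K : ℚ)).entireLFunction 1 ≠ 0)
    (hP : WeierstrassCurve.Affine.Point.map ι.toRatAlgHom P = heegnerPointComplex Dt H)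
    (f : ℕ) [NeZero f] (ψ : DirichletCharacter ℚ_[p] f) (ω : DirichletCharacter ℚ_[p] p)
    (hψ : ψ.IsPrimitive) (hω : KrizLi2019.IsTeichmullerCharacter ω)
    (hss : ∀ ℓ : ℕ, ℓ.Prime → ¬ (ℓ ∣ p * W.conductorNorm ℤ) →
      ‖((W.LFunction ℓ : ℤ) : ℚ_[p]) - (ψ (ℓ : ZMod f) + ψ⁻¹ (ℓ : ZMod f) * ω (ℓ : ZMod p))‖ < 1)
    (h1 : ψ (p : ZMod f) ≠ 1) (h1' : KrizLi2019.primVal (KrizLi2019.invMulOmega ψ ω) p ≠ 1)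
    (h3 : ∀ ℓ : ℕ, (hℓ : ℓ.Prime) → ℓ ≠ p →
      (haveI := Fact.mk hℓ; ¬ W.HasGoodReductionAtPrime ℓ ∧ ¬ W.HasMultiplicativeReductionAtPrime ℓ) →
      ψ (ℓ : ZMod f) ≠ 1 ∧ KrizLi2019.primVal (KrizLi2019.invMulOmega ψ ω) ℓ ≠ 1)
    (εK : DirichletCharacter ℚ_[p] (NumberField.discr K).natAbs) (hεK : KrizLi2019.IsKroneckerCharacterOf K εK)
    (h4 : ¬ (‖KrizLi2019.bernoulliOnePrim (KrizLi2019.bernoulliCharOne ψ εK) *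
        KrizLi2019.bernoulliOnePrim (KrizLi2019.bernoulliCharTwo ψ εK ω)‖ ≤ (p : ℝ)⁻¹))
    -- the ONE input beyond print at this datum: Kolyvagin's direction of the Heegner-index identity
    (hup : ¬ IsOfFinAddOrder P → Upper.IndexUpperBoundLeAt W p K P (padicValNat p Dt.c.natAbs)) :
    BSDp W p := by
  have hp : p.Prime := Fact.out
  have hp2 : p ≠ 2 := by omega
  subst hN
  obtain ⟨-, -, hF, hPT2, hBF, hmod, -⟩ := hprints
  obtain ⟨hGZ, hKo, hGZK, -, -, -, hGZ73, -, -, -⟩ := hF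
  have hadd : Addv W p := addv_of_cmRamified W hCM hram h5
  have hpN : p ∣ W.conductorNorm ℤ := (W.dvd_conductorNorm_iff_not_hasGoodReductionAtPrime p).mpr hadd.1
  -- the Heegner point is non-torsion (Gross–Zagier at `r_an(E/K) = 1`)
  have hL0 : W.entireLFunction 1 = 0 := entireLFunction_one_eq_zero_of_analyticRank_eq_one hr
  obtain ⟨-, hderiv⟩ := leadingLCoeff_eq_deriv_of_analyticRank_eq_one hr
  have hLK : LDerivEK W K ≠ 0 := by
    rw [lDerivEK_eq_deriv_mul W K hmod hL0]; exact mul_ne_zero hderiv hLt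
  have hnt : ¬ IsOfFinAddOrder P :=
    (lDerivEK_ne_zero_iff_not_isOfFinAddOrder W (W.conductorNorm ℤ) K (hGZ _ W K) hK hHN ⟨Dt, H, ι, hP⟩).mp hLK
  -- LOWER half: print (§1); UPPER half: the hypothesis
  have hlo : IndexLowerBoundLeAt W p K P (padicValNat p Dt.c.natAbs) :=
    indexLowerBoundLeAt_cmRamified_of_krizLiDatum hPT2 hKo hKL W hCM hram h5 (W.conductorNorm ℤ) K Dt H ι P rfl hK hHN hLt hP
      hnt f ψ ω hψ hω hss h1 h1' h3 εK hεK h4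
  have hupI : Upper.IndexUpperBoundLeAt W p K P (padicValNat p Dt.c.natAbs) := hup hnt
  -- `p ∤ #𝓞_K^×` (`d_K < −4`)
  have hw : ¬ p ∣ Units.torsionOrder K := by
    rw [Literature.NumberTheory.QuadraticFields.Quadratic.torsionOrder_eq_two_of_discr_lt_neg_four hK.1 hd4]
    intro h
    exact hp2 ((Nat.prime_dvd_prime_iff_eq hp Nat.prime_two).mp h)
  -- the rank-zero partner: a globally minimal model of the twist and its `BSD_p` (Burungale–Flach)
  have hD0 : (NumberField.discr K : ℚ) ≠ 0 := by exact_mod_cast NumberField.discr_ne_zero K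
  haveI : (W.quadraticTwist (NumberField.discr K : ℚ)).IsElliptic := W.isElliptic_quadraticTwist hD0
  obtain ⟨Cd, hCd⟩ := hasGlobalMinimalModel_rat_holds (W.quadraticTwist (NumberField.discr K : ℚ))
  haveI : (Cd • W.quadraticTwist (NumberField.discr K : ℚ)).IsGloballyMinimal := hCd
  have hWd : BSDp (Cd • W.quadraticTwist (NumberField.discr K : ℚ)) p :=
    rankZeroTwistBSDp_of_hasCM hBF hmod W hCM (W.conductorNorm ℤ) K (Cd • W.quadraticTwist (NumberField.discr K : ℚ)) rfl hK
      hHN ⟨Cd, rfl⟩ hLt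
  exact SchneiderFree.Exact.bsdp_of_exactIndexManin_of_partner_bsdp hGZ hKo hGZK hmod hGZ73 W p (W.conductorNorm ℤ) K Dt H ι P
    (Cd • W.quadraticTwist (NumberField.discr K : ℚ)) hr rfl hpN hK hodd hw hHN hLt hP ⟨Cd, rfl⟩ hp2 hlo hupI hWd

/-- **C2's conclusion `RamifiedCMBottomClassIndexLawAtZp W p` at a KRIZ–LI DATUM from the UPPER index half at that datum** (and
print): `bsdp_cmRamified_of_krizLiDatum_of_indexUpper` then k7r-c4's `ramifiedCMBottomClassIndexLawAtZp_of_bsdp` (Cassels, modularity,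
GZK). This is the crux `BottomClassIndexLawFiveLe` RESTRICTED to the Kriz–Li locus, MODULO one finite-level Kolyvagin inequality per
member; the class-wide crux stays open. CONDITIONAL on the named facts.
[cite: KrizLi2019, Thm. 1.20 (pp. 7–8), Rem. 1.21 (p. 8)] [cite: Miller2011LMS, Def. 1.1 (arXiv:1010.2431 p. 3)]
[cite: GrigorovJorzaPatrikisSteinTarnita2009, Thm. 3.7] -/
theorem ramifiedCMBottomClassIndexLawAtZp_of_krizLiDatum_of_indexUpper
    (hprints : Hsieh2014.thmA_exists_isHsiehLFunction_unrPeriod_anyLevel ∧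
      LiuZhangZhang2018.thm151_thm153_modularCurve_heegnerVector_additive ∧
      ToricPublishedInputs ∧
      (∀ (K : Type) [Field K] [NumberField K], poitouTate_sha_tateDual K) ∧
      bsdTriple_of_hasCM_of_L_one_ne_zero ∧ hasEntireLFunction_rat ∧ bsdRHS_eq_of_isIsogenous)
    (hKL : KrizLi2019.thm120_padicLogHeegner_unit_of_bernoulli)
    (W : WeierstrassCurve ℚ) [W.IsElliptic] [W.IsGloballyMinimal] (hCM : W.HasCM) (hram : CMRamified W p) (h5 : 5 ≤ p)
    (hr : W.analyticRank = 1)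
    (N : ℕ) [NeZero N] (K : Type) [Field K] [NumberField K]
    (Dt : ModularParametrizationData W N) (H : HeegnerDatum N (NumberField.discr K)) (ι : K →+* ℂ)
    (P : (W.baseChange K).toAffine.Point)
    (hN : W.conductorNorm ℤ = N) (hK : IsImaginaryQuadratic K) (hHN : SatisfiesHeegnerHypothesis N K)
    (hodd : Odd (NumberField.discr K)) (hd4 : NumberField.discr K < -4)
    (hLt : (W.quadraticTwist (NumberField.discr K : ℚ)).entireLFunction 1 ≠ 0)
    (hP : WeierstrassCurve.Affine.Point.map ι.toRatAlgHom P = heegnerPointComplex Dt H)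
    (f : ℕ) [NeZero f] (ψ : DirichletCharacter ℚ_[p] f) (ω : DirichletCharacter ℚ_[p] p)
    (hψ : ψ.IsPrimitive) (hω : KrizLi2019.IsTeichmullerCharacter ω)
    (hss : ∀ ℓ : ℕ, ℓ.Prime → ¬ (ℓ ∣ p * W.conductorNorm ℤ) →
      ‖((W.LFunction ℓ : ℤ) : ℚ_[p]) - (ψ (ℓ : ZMod f) + ψ⁻¹ (ℓ : ZMod f) * ω (ℓ : ZMod p))‖ < 1)
    (h1 : ψ (p : ZMod f) ≠ 1) (h1' : KrizLi2019.primVal (KrizLi2019.invMulOmega ψ ω) p ≠ 1)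
    (h3 : ∀ ℓ : ℕ, (hℓ : ℓ.Prime) → ℓ ≠ p →
      (haveI := Fact.mk hℓ; ¬ W.HasGoodReductionAtPrime ℓ ∧ ¬ W.HasMultiplicativeReductionAtPrime ℓ) →
      ψ (ℓ : ZMod f) ≠ 1 ∧ KrizLi2019.primVal (KrizLi2019.invMulOmega ψ ω) ℓ ≠ 1)
    (εK : DirichletCharacter ℚ_[p] (NumberField.discr K).natAbs) (hεK : KrizLi2019.IsKroneckerCharacterOf K εK)
    (h4 : ¬ (‖KrizLi2019.bernoulliOnePrim (KrizLi2019.bernoulliCharOne ψ εK) *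
        KrizLi2019.bernoulliOnePrim (KrizLi2019.bernoulliCharTwo ψ εK ω)‖ ≤ (p : ℝ)⁻¹))
    (hup : ¬ IsOfFinAddOrder P → Upper.IndexUpperBoundLeAt W p K P (padicValNat p Dt.c.natAbs)) :
    X12.O11.RamifiedCMBottomClassIndexLawAtZp W p := by
  have hpr := hprints
  obtain ⟨-, -, ⟨-, -, hGZK, -⟩, -, -, hmod, hCassels⟩ := hpr
  exact RubinFormulaZpBsdp.ramifiedCMBottomClassIndexLawAtZp_of_bsdp hCassels hmod hGZK hr.le
    (bsdp_cmRamified_of_krizLiDatum_of_indexUpper hprints hKL W hCM hram h5 hr N K Dt H ι P hN hK hHN hodd hd4 hLt hP f ψ ω hψ hω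
      hss h1 h1' h3 εK hεK h4 hup)


/-- **Converse bookkeeping: at a Kriz–Li datum the UPPER index half FORCES the frame to be REGULAR.** For a class member and
a Kriz–Li datum as in §1, at any anticyclotomic frame `(κ, γ, 𝔭 ∋ p)`: if `Upper.IndexUpperBoundLeAt W p K P (v_p c)` holds then
`X_(∅,0)(W/K_∞)` has a UNIT characteristic power series (`XAc.HasCharValuationAt … 0`). Indeed control turns the index half into
the socket `n + 2·v_p(c) ≤ 2·ord_p log_ω P` and Kriz–Li gives `ord_p log_ω P ≤ v_p(c)`, so `n = 0`. Hence on the Kriz–Li locus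
«Kolyvagin's inequality at the datum», «the frame is regular» (LEAD g5's `hreg`) and «`BSD_p(W)`» coincide modulo print.
[cite: KrizLi2019, Thm. 1.20 (pp. 7–8), Rem. 1.17 (p. 6)] [cite: JetchevSkinnerWan2017, §7.4.1 and Thm. 3.3.1 (arXiv:1512.06894 pp. 11, 30)] -/
theorem hasCharValuationAt_zero_of_indexUpper_of_krizLiDatum
    (hPT2 : ∀ (K : Type) [Field K] [NumberField K], poitouTate_sha_tateDual K)
    (hKo : ∀ (N : ℕ) [NeZero N] (W : WeierstrassCurve ℚ) (K : Type) [Field K] [NumberField K],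
      Literature.NumberTheory.EllipticCurves.kolyvagin N W K)
    (hKL : KrizLi2019.thm120_padicLogHeegner_unit_of_bernoulli)
    (W : WeierstrassCurve ℚ) [W.IsElliptic] [W.IsGloballyMinimal] (hCM : W.HasCM) (hram : CMRamified W p) (h5 : 5 ≤ p)
    (N : ℕ) [NeZero N] (K : Type) [Field K] [NumberField K]
    (Dt : ModularParametrizationData W N) (H : HeegnerDatum N (NumberField.discr K)) (ι : K →+* ℂ)
    (P : (W.baseChange K).toAffine.Point)
    (hN : W.conductorNorm ℤ = N) (hK : IsImaginaryQuadratic K) (hHN : SatisfiesHeegnerHypothesis N K)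
    (hLt : (W.quadraticTwist (NumberField.discr K : ℚ)).entireLFunction 1 ≠ 0)
    (hP : WeierstrassCurve.Affine.Point.map ι.toRatAlgHom P = heegnerPointComplex Dt H) (hnt : ¬ IsOfFinAddOrder P)
    (f : ℕ) [NeZero f] (ψ : DirichletCharacter ℚ_[p] f) (ω : DirichletCharacter ℚ_[p] p)
    (hψ : ψ.IsPrimitive) (hω : KrizLi2019.IsTeichmullerCharacter ω)
    (hss : ∀ ℓ : ℕ, ℓ.Prime → ¬ (ℓ ∣ p * W.conductorNorm ℤ) →
      ‖((W.LFunction ℓ : ℤ) : ℚ_[p]) - (ψ (ℓ : ZMod f) + ψ⁻¹ (ℓ : ZMod f) * ω (ℓ : ZMod p))‖ < 1)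
    (h1 : ψ (p : ZMod f) ≠ 1) (h1' : KrizLi2019.primVal (KrizLi2019.invMulOmega ψ ω) p ≠ 1)
    (h3 : ∀ ℓ : ℕ, (hℓ : ℓ.Prime) → ℓ ≠ p →
      (haveI := Fact.mk hℓ; ¬ W.HasGoodReductionAtPrime ℓ ∧ ¬ W.HasMultiplicativeReductionAtPrime ℓ) →
      ψ (ℓ : ZMod f) ≠ 1 ∧ KrizLi2019.primVal (KrizLi2019.invMulOmega ψ ω) ℓ ≠ 1)
    (εK : DirichletCharacter ℚ_[p] (NumberField.discr K).natAbs) (hεK : KrizLi2019.IsKroneckerCharacterOf K εK)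
    (h4 : ¬ (‖KrizLi2019.bernoulliOnePrim (KrizLi2019.bernoulliCharOne ψ εK) *
        KrizLi2019.bernoulliOnePrim (KrizLi2019.bernoulliCharTwo ψ εK ω)‖ ≤ (p : ℝ)⁻¹))
    (κ : ZpExtension K p) (hκ : κ.IsAnticyclotomic) (γ : Field.absoluteGaloisGroup K) [Fact (κ.IsTopGenerator γ)]
    (𝔭 : HeightOneSpectrum (𝓞 K)) (h𝔭 : ((p : ℕ) : 𝓞 K) ∈ 𝔭.asIdeal)
    (hupI : Upper.IndexUpperBoundLeAt W p K P (padicValNat p Dt.c.natAbs)) :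
    XAc.HasCharValuationAt (W.baseChange K) p κ 𝔭 ∅ γ 0 := by
  have hp : p.Prime := Fact.out
  have hp2 : p ≠ 2 := by omega
  obtain ⟨hPT, hEP, hcd, hBr⟩ := EisensteinResourceBdpLine.prints_four_hold
  have hadd : Addv W p := addv_of_cmRamified W hCM hram h5
  have hpNW : p ∣ W.conductorNorm ℤ := (W.dvd_conductorNorm_iff_not_hasGoodReductionAtPrime p).mpr hadd.1
  have hpN : p ∣ N := by rw [← hN]; exact hpNW
  have hsplit : ((Ideal.span {(p : ℤ)}).primesOver (𝓞 K)).ncard = 2 := hHN p hp hpN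
  obtain ⟨he, hf⟩ := degreeOne_of_dvd_of_heegner hK hHN hpN h𝔭
  obtain ⟨_, hfin⟩ := hKo N W K hK hHN ⟨Dt, H, ι, hP⟩ hnt
  have hCtl : AdditiveControlOnTreeAt p κ 𝔭 γ (embAt K p 𝔭 h𝔭 he hf) P :=
    additiveControl_heegner_of_cmRamified hPT hPT2 hEP hcd hBr W hCM hram h5 N K Dt H ι P hN hK hHN hLt hP hnt
      (hKo N W K) κ hκ γ 𝔭 h𝔭 he hf
  -- the UPPER socket from the index half and control: `n + 2·v_p(c) ≤ 2·ord_p log_ω P`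
  obtain ⟨n, hn, hle⟩ :=
    Upper.additiveIMCUpperBDPOnTreeLeAt_of_indexUpperBoundLeAt_of_control hN hK hHN hfin hupI hCtl
  -- Kriz–Li: `ord_p log_ω P ≤ v_p(c)`
  have h2 : ∀ ℓ : ℕ, (hℓ : ℓ.Prime) → ¬ (haveI := Fact.mk hℓ; W.HasSplitMultiplicativeReductionAtPrime ℓ) :=
    fun ℓ hℓ hsp ↦ by
      haveI := Fact.mk hℓ
      exact W.not_hasMultiplicativeReductionAtPrime_of_hasCM hCM ℓ hsp.hasMultiplicativeReductionAtPrime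
  have hlog : X11b.padicLogOrd W p (embAt K p 𝔭 h𝔭 he hf) P ≤ (padicValInt p Dt.c : ℤ) := by
    subst hN
    haveI : NeZero (NumberField.discr K).natAbs := ⟨Int.natAbs_ne_zero.mpr (NumberField.discr_ne_zero K)⟩
    have hne := hKL p hp2 W f ψ ω hψ hω hss h1 h1' h2 h3 Dt K hK hHN hsplit εK hεK H ι (embAt K p 𝔭 h𝔭 he hf) P hP h4
    exact (padicLogOrd_le_padicValInt_of_krizLi (nsPointCount_eq_self_of_addv hadd) hne).2.2
  have hc : (padicValInt p Dt.c : ℤ) = (padicValNat p Dt.c.natAbs : ℤ) := rfl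
  have hn0 : n = 0 := by omega
  subst hn0
  exact hn

end KrizLiDatum

end Summit.BirchSwinnertonDyer.BirchSwinnertonDyer.Theorems.PrintCFram.KrizLiKolyvagin

end
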